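import Literature.NumberTheory.Automorphic.BrandtModuleEichlerPackageProofs
import Literature.NumberTheory.Automorphic.QuaternionRamificationParityRat
import Literature.NumberTheory.Automorphic.MaximalOrderRamifiedPrime
import Literature.NumberTheory.Automorphic.BrandtModuleDictionary
import HarnessLib

/-!
# Admissible levels: Brandt setups of type `(N⁺, N⁻)` exist iff `N⁺ ≥ 1`, `N⁻` is squarefree
# with an odd number of prime factors, and `gcd(N⁺, N⁻) = 1`

Topic `NumberTheory/Automorphic`; theorems only (no definition, no named fact, no instance).
`brandtXi N⁺ N⁻ λ` (`BrandtXi.lean`) has the junk value `0` when there is no Brandt setup of type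
`(N⁺, N⁻)` (`Brandt.XiSetup`: a definite quaternion algebra over `ℚ` ramified exactly at the
primes dividing the squarefree `N⁻`, with an Eichler order of level `N⁺`). The sufficiency of
the classical conditions is the tree's `Brandt.nonempty_xiSetup_of_nonempty_eichlerPackage` with
the DISCHARGED named fact `nonempty_eichlerPackage_holds`; this file proves their necessity and
records the characterisation:

* `EichlerPackage.odd_card_primeFactors`, `Brandt.XiSetup.odd_card_primeFactors` — `ω(N⁻)` is odd
  (parity of ramification, `even_card_ramified_rat`: the ramified places are the `ω(N⁻)` finite
  ones and the unique infinite place);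
* `EichlerPackage.nplus_pos'`, `EichlerPackage.coprime`, `Brandt.XiSetup.coprime` — `N⁺ ≥ 1`
  (a finite index of full lattices) and `gcd(N⁺, N⁻) = 1` (at a prime `q ∣ N⁻` all maximal orders
  agree locally, `IsMaximalZOrder.localAt_eq_of_not_isSplitAt`, so an Eichler order `O₁ ∩ O₂` has
  local index `1 = q^{v_q(N⁺)}` there, `relIndex_localAt`);
* `Brandt.nonempty_xiSetup_iff_admissible` — **`Nonempty (XiSetup N⁺ N⁻) ↔ 0 < N⁺ ∧ N⁻ squarefree
  ∧ ω(N⁻) odd ∧ gcd(N⁺, N⁻) = 1`**;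
* `Brandt.nonempty_xiSetup_of_squarefree_mul` — in particular under the standing hypotheses of
  Pollack–Weston 2011, Thm. 6.8 (`N = N⁺N⁻` squarefree, `ω(N⁻)` odd, `N ≠ 0`) a setup exists, so
  `brandtXi N⁺ N⁻` is the genuine congruence number (`exists_brandtXi_eq`).

## References

* M.-F. Vignéras, *Arithmétique des algèbres de quaternions*, LNM 800 (1980), Ch. III §3
  Thm. 3.1 (parity and existence), Ch. II §1 Lemme 1.5, §2 Lemme 2.4, Ch. III §5 (Eichler orders)
  [VignerasLNM800].
* R. Pollack, T. Weston, Compos. Math. 147 (2011), § Notation and §2.1 [PollackWeston2011].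
-/

noncomputable section

open scoped Pointwise
open NumberField IsDedekindDomain

namespace Literature.NumberTheory.Automorphic

variable {Nplus Nminus : ℕ}

/-! ### Necessity for Eichler packages -/

namespace EichlerPackage

/-- A package forces `N⁻ ≠ 0` (otherwise the algebra would be ramified at every finite place,
contradicting `ramifiedPlaces_finite`). [folklore] -/
theorem nminus_ne_zero (P : EichlerPackage Nplus Nminus) : Nminus ≠ 0 := by
  rintro rfl
  have hall : ramifiedPlaces ℚ P.B = Set.univ := Set.eq_univ_iff_forall.mpr fun v =>
    (P.mem_ramifiedPlaces_iff v).mpr (by rw [Nat.cast_zero]; exact Submodule.zero_mem _)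
  have hfin := ramifiedPlaces_finite_holds ℚ P.B
  rw [hall] at hfin
  haveI : Infinite Nat.Primes := Set.infinite_coe_iff.mpr Nat.infinite_setOf_prime
  haveI : Infinite (HeightOneSpectrum (𝓞 ℚ)) :=
    Infinite.of_injective _ (Rat.HeightOneSpectrum.primesEquiv (R := 𝓞 ℚ)).symm.injective
  exact Set.infinite_univ hfin

/-- **`ω(N⁻)` is odd** for the level of an Eichler package: the algebra is ramified at the
`ω(N⁻)` finite places above `N⁻` and at the unique infinite place of `ℚ`, and the total number of
ramified places is even (`even_card_ramified_rat`). [cite: VignerasLNM800, Ch. III §3 Thm. 3.1] -/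
theorem odd_card_primeFactors (P : EichlerPackage Nplus Nminus) : Odd Nminus.primeFactors.card := by
  have hev := even_card_ramified_rat P.B
  obtain ⟨T, hT, hcard⟩ := exists_finset_places_dvd Nminus P.nminus_ne_zero
  have hram : ramifiedPlaces ℚ P.B = ↑T := Set.ext fun v => by
    rw [P.mem_ramifiedPlaces_iff, Finset.mem_coe, hT]
  have hinf : ramifiedInfinitePlaces ℚ P.B = Set.univ :=
    Set.eq_univ_iff_forall.mpr fun w => P.isTotallyDefinite w
  rw [hram, hinf, Set.ncard_coe_finset, Set.ncard_univ, Nat.card_unique, hcard,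
    Nat.even_add_one, Nat.not_even_iff_odd] at hev
  exact hev

/-- `N⁺ ≥ 1` for the level of an Eichler package (the level is a finite index of full lattices).
[folklore] -/
theorem nplus_pos' (P : EichlerPackage Nplus Nminus) : 0 < Nplus := by
  haveI : IsAddTorsionFree P.B := isAddTorsionFree_of_charZero_module ℚ P.B
  obtain ⟨O₁, O₂, h₁, -, hO12, hidx⟩ := P.isEichlerOrder
  obtain ⟨n, hn, hnO⟩ := exists_smul_mem_of_fg P.isEichlerOrder.isZOrder.isFullLattice
    h₁.1.isFullLattice.1
  rw [← hidx]
  exact Nat.pos_of_ne_zero (relIndex_ne_zero_of_smul_mem O₁ h₁.1.isFullLattice.1 hn P.O hnO)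

/-- **`gcd(N⁺, N⁻) = 1`** for the level of an Eichler package: at a prime `q ∣ N⁻` the algebra is
ramified, all maximal orders have the same localisation (`IsMaximalZOrder.localAt_eq_of_not_isSplitAt`),
so the Eichler order `O = O₁ ∩ O₂` has `O₍q₎ = O₁,₍q₎`, i.e. local index `1`; but the local index
is `q^{v_q(N⁺)}` (`relIndex_localAt`), whence `q ∤ N⁺`. [cite: VignerasLNM800, Ch. II §1 Lemme 1.5 and Ch. III §5 (niveau d'un ordre d'Eichler)] -/
theorem coprime (P : EichlerPackage Nplus Nminus) : Nat.Coprime Nplus Nminus := by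
  by_contra hnc
  obtain ⟨q, hq, hqNp, hqNm⟩ := Nat.Prime.not_coprime_iff_dvd.mp hnc
  haveI : Fact q.Prime := ⟨hq⟩
  have hN0 : Nplus ≠ 0 := P.nplus_pos'.ne'
  obtain ⟨O₁, O₂, h₁, h₂, hO12, hidx⟩ := P.isEichlerOrder
  -- `q` is ramified
  set v : HeightOneSpectrum (𝓞 ℚ) := (Rat.HeightOneSpectrum.primesEquiv (R := 𝓞 ℚ)).symm ⟨q, hq⟩
    with hv
  have hvq : ((Rat.HeightOneSpectrum.primesEquiv v : Nat.Primes) : ℕ) = q := by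
    rw [hv, Equiv.apply_symm_apply]
  have hvs : ¬ IsSplitAt P.B v := by
    intro hsplit
    have hmem : v ∈ ramifiedPlaces ℚ P.B := by
      rw [P.mem_ramifiedPlaces_iff, ← primesEquiv_dvd_iff, hvq]
      exact hqNm
    exact hmem hsplit
  -- local index `1` …
  have hloc : localAt q P.O = localAt q O₁ := by
    rw [hO12, localAt_inf, h₂.localAt_eq_of_not_isSplitAt h₁ v hvs hvq, inf_idem]
  -- … equals `q^{v_q(N⁺)}`
  have hle : P.O ≤ O₁ := hO12 ▸ inf_le_left
  have hidx' := relIndex_localAt (p := q) O₁ P.O hle (by rw [hidx]; exact hN0)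
  rw [hidx, hloc, AddSubgroup.relIndex_self] at hidx'
  have hzero : Nplus.factorization q = 0 := by
    rcases (Nat.pow_eq_one.mp hidx'.symm) with h | h
    · exact absurd h hq.one_lt.ne'
    · exact h
  exact absurd hzero (hq.factorization_pos_of_dvd hN0 hqNp).ne'

end EichlerPackage

/-! ### Necessity for Brandt setups and the characterisation -/

namespace Brandt

/-- `ω(N⁻)` is odd for the type of a Brandt setup. [cite: VignerasLNM800, Ch. III §3 Thm. 3.1] -/
theorem XiSetup.odd_card_primeFactors (S : XiSetup Nplus Nminus) : Odd Nminus.primeFactors.card :=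
  S.toEichlerPackage.odd_card_primeFactors

/-- `gcd(N⁺, N⁻) = 1` for the type of a Brandt setup. [cite: VignerasLNM800, Ch. III §5 (niveau d'un ordre d'Eichler)] -/
theorem XiSetup.coprime (S : XiSetup Nplus Nminus) : Nat.Coprime Nplus Nminus :=
  S.toEichlerPackage.coprime

/-- `N⁺ ≥ 1` for the type of a Brandt setup. [folklore] -/
theorem XiSetup.nplus_pos (S : XiSetup Nplus Nminus) : 0 < Nplus :=
  S.toEichlerPackage.nplus_pos'

/-- **Admissible levels.** A Brandt setup of type `(N⁺, N⁻)` exists iff `N⁺ ≥ 1`, `N⁻` is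
squarefree with an odd number of prime factors, and `gcd(N⁺, N⁻) = 1` (necessity: this file;
sufficiency: `nonempty_xiSetup_of_nonempty_eichlerPackage` with `nonempty_eichlerPackage_holds`,
i.e. Vignéras III §3 Thm. 3.1 and the construction of Eichler orders). [cite: VignerasLNM800, Ch. III §3 Thm. 3.1 and Ch. III §5] -/
theorem nonempty_xiSetup_iff_admissible :
    Nonempty (XiSetup Nplus Nminus) ↔
      0 < Nplus ∧ Squarefree Nminus ∧ Odd Nminus.primeFactors.card ∧ Nat.Coprime Nplus Nminus := by
  constructor
  · rintro ⟨S⟩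
    exact ⟨S.nplus_pos, S.squarefree, S.odd_card_primeFactors, S.coprime⟩
  · rintro ⟨h0, hsq, hodd, hcop⟩
    exact nonempty_xiSetup_of_nonempty_eichlerPackage nonempty_eichlerPackage_holds h0 hsq hodd hcop

/-- **Under the standing hypotheses of Pollack–Weston 2011, Thm. 6.8** (`N = N⁺N⁻ ≠ 0`
squarefree, `ω(N⁻)` odd) **a Brandt setup of type `(N⁺, N⁻)` exists.** [cite: PollackWeston2011, § Notation and §2.1] -/
theorem nonempty_xiSetup_of_squarefree_mul [NeZero (Nplus * Nminus)]
    (hsq : Squarefree (Nplus * Nminus)) (hodd : Odd Nminus.primeFactors.card) :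
    Nonempty (XiSetup Nplus Nminus) :=
  nonempty_xiSetup_iff_admissible.mpr
    ⟨Nat.pos_of_ne_zero (left_ne_zero_of_mul (NeZero.ne (Nplus * Nminus))),
      Squarefree.of_mul_right hsq, hodd, Nat.coprime_of_squarefree_mul hsq⟩

/-- Hence, under those hypotheses, `brandtXi N⁺ N⁻ λ` is `S.xi λ` for some (by
`Brandt.XiSetup.xi_eq_brandtXi` of `BrandtXiCanonical.lean`: for every) setup `S` — not the junk
value. [cite: PollackWeston2011, §2.1] -/
theorem exists_brandtXi_eq_of_squarefree_mul [NeZero (Nplus * Nminus)]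
    (hsq : Squarefree (Nplus * Nminus)) (hodd : Odd Nminus.primeFactors.card) (lam : ℕ → ℤ) :
    ∃ S : XiSetup Nplus Nminus, brandtXi Nplus Nminus lam = S.xi lam :=
  exists_brandtXi_eq (nonempty_xiSetup_of_squarefree_mul hsq hodd) lam

end Brandt

end Literature.NumberTheory.Automorphic

end
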